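import Literature.AlgebraicTopology.SingularHomology.RelativeEilenbergRetractionProofs
import HarnessLib

/-!
# Spanier's deformation `P(σ)` of `Δ(X)` onto `Δ(X, A, x₀)ᵐ`, with the homotopies exposed

Topic `Literature/AlgebraicTopology/SingularHomology`. E. H. Spanier, *Algebraic Topology* (1966;
Springer 1981), Ch. 7 §4, Lemma 7 and Thm. 8 (p. 393 of the held copy): for an `m`-connected pair
`(X, A)` with `X`, `A` path connected, homotopies `P(σ) : Δ^q × I → X` of all singular simplices
with (a) `P(σ)(·, 0) = σ`, (b) `σ̄ = P(σ)(·, 1)` in `Δ(X, A, x₀)ᵐ` and `P(σ) = σ ∘ p` when `σ` is in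
the subcomplex, (c) `P(σ) ∘ (e^i_q × 1) = P(σ⁽ⁱ⁾)`, and (Cor. 9) `P(σ) ⊆ A` for `σ ⊆ A`.

The tower is constructed, level by level, in `RelativeEilenbergRetractionProofs.lean`
(`RelEilenbergRetraction.exists_level_zero` / `exists_level_succ`, properties
`RelEilenbergRetraction.LevelGood`), but only its END MAPS are packaged there (as a
`RelEilenbergRetraction`, discharging `nonempty_relEilenbergRetraction`) — which is all that the
vanishing form of the relative Hurewicz theorem needs. The isomorphism clause
(`relativeHurewicz_equiv`, through Spanier's Cor. 7.4.9 `isIso_toRelativeHomology`,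
`RelativeEilenbergSubcomplex.lean`) needs the chain homotopy `∂D + D∂ = τ - 1` of Lemma 7.4.7, i.e.
the homotopies `P(σ)` themselves. This short file exposes them, everything PROVED:

* `RelEilenbergDeformation X A x₀ m` (**structure**) — the homotopies `P` of all dimensions with
  (a), (c), end maps relative Eilenberg of level `m`, `P` stationary on relative Eilenberg simplices,
  and `P(σ) ⊆ A` for `σ ⊆ A` (the absolute analogue is `EilenbergTower`, `EilenbergDeformation.lean`);
* `nonempty_relEilenbergDeformation` — it exists under the hypotheses of
  `nonempty_relEilenbergRetraction` (the same recursion on the dimension over the levels of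
  `RelativeEilenbergRetractionProofs.lean`);
* `RelEilenbergDeformation.endSimplex`, `endSimplex_face`, `endSimplex_eq_self`,
  `range_endSimplex_subset`, `toRetraction` — the end maps and the retraction they form.

The prism operator and Cor. 7.4.9 are drawn in `RelativeEilenbergSubcomplexProofs.lean`.

## References

* E. H. Spanier, *Algebraic Topology*, Springer (1981), Ch. 7 §4, Lemma 7, Thm. 8, Cor. 9
  (pp. 392–393). [Spanier1981]
-/

noncomputable section

open Set
open scoped Topology unitInterval

universe u

namespace Literature.AlgebraicTopology.SingularHomology

open Literature.AlgebraicTopology.Homotopy (RelHomotopyGroup)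
open SingularSimplex

variable {X : Type u} [TopologicalSpace X]

variable (X) in
/-- **Spanier's deformation of `Δ(X)` onto `Δ(X, A, x₀)ᵐ`** (Lemma 7.4.7 and the proof of
Thm. 7.4.8, with the bookkeeping of Cor. 7.4.9): homotopies `P σ : Δ^q × I → X` of the singular
simplices of every dimension with (a) `P σ (·, 0) = σ`, (c) `P σ ∘ (δᵢ × 1) = P (σ⁽ⁱ⁾)`, (b) end maps
in the subcomplex (relative Eilenberg of level `m`), `P σ` stationary on relative Eilenberg simplices
("`P(σ) = σ ∘ p`", so `σ̄ = σ` there), and `P σ ⊆ A` for `σ ⊆ A` (so that the same data deform `Δ(A)`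
onto `Δ(X, A, x₀)ᵐ ∩ Δ(A)`). [cite: Spanier1981, Ch. 7 §4 Lemma 7 and Thm. 8] -/
structure RelEilenbergDeformation (A : Set X) (x₀ : X) (m : ℕ) where
  /-- Spanier's `P(σ)` -/
  P : ∀ {q : ℕ}, SingularSimplex X q → C(StdSimplex q × I, X)
  /-- (a) `P σ (·, 0) = σ` -/
  P_zero : ∀ {q : ℕ} (sg : SingularSimplex X q) (t : StdSimplex q), P sg (t, 0) = toContinuousMap sg t
  /-- (c) compatibility with the faces -/
  P_stdFace : ∀ {q : ℕ} (sg : SingularSimplex X (q + 1)) (i : Fin (q + 2)) (t : StdSimplex q) (s : I),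
    P sg (stdFace i t, s) = P (sg.face i) (t, s)
  /-- (b) the end map sends the `m`-skeleton into `A` -/
  P_one_mem : ∀ {q : ℕ} (sg : SingularSimplex X q), ∀ t ∈ stdSkel q m, P sg (t, 1) ∈ A
  /-- (b) the end map sends the vertices to `x₀` -/
  P_one_vertex : ∀ {q : ℕ} (sg : SingularSimplex X q) (i : Fin (q + 1)), P sg (stdSimplex.vertex (S := ℝ) i, 1) = x₀
  /-- relative Eilenberg simplices carry the stationary homotopy -/
  P_of_isRelEilenberg : ∀ {q : ℕ} (sg : SingularSimplex X q), IsRelEilenberg A x₀ m sg →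
    ∀ (t : StdSimplex q) (s : I), P sg (t, s) = toContinuousMap sg t
  /-- simplices of `A` are deformed inside `A` -/
  P_mem : ∀ {q : ℕ} (sg : SingularSimplex X q), sg.range ⊆ A → ∀ (t : StdSimplex q) (s : I), P sg (t, s) ∈ A

namespace RelEilenbergDeformation

variable {A : Set X} {x₀ : X} {m : ℕ} (D : RelEilenbergDeformation X A x₀ m)

/-- **The end map `σ̄ = P(σ)(·, 1)`** of the deformation, as a singular simplex (Spanier's `σ̄`).
[cite: Spanier1981, Ch. 7 §4 Lemma 7] -/
def endSimplex {q : ℕ} (sg : SingularSimplex X q) : SingularSimplex X q :=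
  ofMap ⟨fun t => D.P sg (t, 1), (D.P sg).continuous.comp (continuous_id.prodMk continuous_const)⟩

/-- Value of the end map. [folklore] -/
@[simp] lemma toContinuousMap_endSimplex_apply {q : ℕ} (sg : SingularSimplex X q) (t : StdSimplex q) :
    toContinuousMap (D.endSimplex sg) t = D.P sg (t, 1) := by
  rw [endSimplex, toContinuousMap_ofMap]; rfl

/-- `σ̄` is a relative Eilenberg simplex of level `m`, by (b). [cite: Spanier1981, Ch. 7 §4 Lemma 7] -/
lemma isRelEilenberg_endSimplex {q : ℕ} (sg : SingularSimplex X q) : IsRelEilenberg A x₀ m (D.endSimplex sg) :=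
  ⟨fun t ht => by rw [toContinuousMap_endSimplex_apply]; exact D.P_one_mem sg t ht,
    fun i => by rw [toContinuousMap_endSimplex_apply]; exact D.P_one_vertex sg i⟩

/-- `σ̄⁽ⁱ⁾ = σ⁽ⁱ⁾‾`, by (c). [cite: Spanier1981, Ch. 7 §4 Lemma 7] -/
lemma endSimplex_face {q : ℕ} (sg : SingularSimplex X (q + 1)) (i : Fin (q + 2)) :
    (D.endSimplex sg).face i = D.endSimplex (sg.face i) := by
  rw [endSimplex, ofMap_face, endSimplex]
  congr 1
  ext t
  exact D.P_stdFace sg i t 1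

/-- `σ̄ = σ` for relative Eilenberg `σ`. [cite: Spanier1981, Ch. 7 §4 Lemma 7] -/
lemma endSimplex_eq_self {q : ℕ} {sg : SingularSimplex X q} (hsg : IsRelEilenberg A x₀ m sg) :
    D.endSimplex sg = sg := by
  conv_rhs => rw [← ofMap_toContinuousMap sg]
  rw [endSimplex]
  congr 1
  ext t
  exact D.P_of_isRelEilenberg sg hsg t 1

/-- `σ̄ ⊆ A` for `σ ⊆ A`. [folklore] -/
lemma range_endSimplex_subset {q : ℕ} {sg : SingularSimplex X q} (hsg : sg.range ⊆ A) :
    (D.endSimplex sg).range ⊆ A := by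
  rintro _ ⟨t, rfl⟩
  rw [toContinuousMap_endSimplex_apply]
  exact D.P_mem sg hsg t 1

/-- **The end maps of the deformation form a relative Eilenberg retraction**
(`RelativeEilenbergRetraction.lean`). [cite: Spanier1981, Ch. 7 §4 Lemma 7 and Thm. 8] -/
def toRetraction : RelEilenbergRetraction X A x₀ m where
  ρ sg := D.endSimplex sg
  face_ρ sg i := D.endSimplex_face sg i
  isRelEilenberg_ρ sg := D.isRelEilenberg_endSimplex sg
  ρ_eq_self _ hsg := D.endSimplex_eq_self hsg
  range_ρ_subset _ hsg := D.range_endSimplex_subset hsg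

/-- The retraction of the deformation is `σ ↦ σ̄`. [folklore] -/
@[simp] lemma toRetraction_ρ {q : ℕ} (sg : SingularSimplex X q) : D.toRetraction.ρ sg = D.endSimplex sg := rfl

end RelEilenbergDeformation

/-- **Spanier's deformation exists for `m`-connected pairs** (Thm. 7.4.8 for pairs, with the
bookkeeping of Cor. 7.4.9): for `X` and `A` path connected, `π_k(X, A, b) = 0` for `1 ≤ k ≤ m` and
all `b ∈ A`, and `x₀ ∈ A`, there is a `RelEilenbergDeformation X A x₀ m` — the levels
`RelEilenbergRetraction.exists_level_zero` / `exists_level_succ` of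
`RelativeEilenbergRetractionProofs.lean`, chosen one dimension at a time, with their homotopies kept.
[cite: Spanier1981, Ch. 7 §4 Thm. 8] -/
theorem nonempty_relEilenbergDeformation [PathConnectedSpace X] (A : Set X) [PathConnectedSpace A]
    (m : ℕ) (hπ : ∀ (k : ℕ) [NeZero k], k ≤ m → ∀ b : A, Subsingleton (RelHomotopyGroup.Pi k X A b))
    (x₀ : A) : Nonempty (RelEilenbergDeformation X A (x₀ : X) m) := by
  -- the tower, one level at a time
  let T := fun q : ℕ =>
    Nat.rec (motive := fun q => {P : SingularSimplex X q → C(StdSimplex q × I, X) //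
        RelEilenbergRetraction.LevelGood A (x₀ : X) m q P})
      ⟨(RelEilenbergRetraction.exists_level_zero x₀ m).choose,
        (RelEilenbergRetraction.exists_level_zero x₀ m).choose_spec⟩
      (fun q s => ⟨(RelEilenbergRetraction.exists_level_succ hπ s.1 s.2).choose,
        (RelEilenbergRetraction.exists_level_succ hπ s.1 s.2).choose_spec.1⟩) q
  -- (c): consecutive levels are compatible with the faces
  have hF : ∀ (q : ℕ) (sg : SingularSimplex X (q + 1)) (i : Fin (q + 2)) (t : StdSimplex q) (s : I),
      (T (q + 1)).1 sg (stdFace i t, s) = (T q).1 (sg.face i) (t, s) :=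
    fun q => (RelEilenbergRetraction.exists_level_succ hπ (T q).1 (T q).2).choose_spec.2
  exact ⟨{ P := fun {q} sg => (T q).1 sg
           P_zero := fun {q} sg t => (T q).2.bot sg t
           P_stdFace := fun {q} sg i t s => hF q sg i t s
           P_one_mem := fun {q} sg t ht => (T q).2.skel sg t ht
           P_one_vertex := fun {q} sg i => (T q).2.vert sg i
           P_of_isRelEilenberg := fun {q} sg hsg => (T q).2.const sg hsg
           P_mem := fun {q} sg hsg => (T q).2.inA sg hsg }⟩

end Literature.AlgebraicTopology.SingularHomology

end
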